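import Literature.Geometry.Manifold.DeRhamComparison
import Literature.AlgebraicTopology.SingularHomology.FinitePunctureCohomology
import Literature.AlgebraicTopology.SingularHomology.CohomologyHomotopyInvariance
import Literature.AlgebraicTopology.SingularHomology.ExcisionMayerVietorisProofs
import Literature.Geometry.Symplectic.StandardEnd
import Literature.Topology.FourManifolds.HomotopySpheres
import HarnessLib

/-!
# Route `SullivanDual`, crux `HyperbolicEnd` (stmt-SmoothPoincare4-7825), line `taubes-circle-pencil`:
# `H²_dR(Σ ∖ p) = 0` — closed `2`-forms on a punctured homotopy `4`-sphere are exact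
# (registered helper `helper_exists_primitive_two_punctured`)

The topological input of the registered stub `stub_noWitnessOffDefect` (S2): for a homotopy
`4`-sphere `Σ` and `p ∈ Σ`, every smooth closed `2`-form on `Σ ∖ p` (`punctured p`) is the
exterior derivative of a smooth `1`-form.  Assembled from landed Literature theorems only:

* singular cohomology: `H²(S⁴; ℝ) = 0` (homology of spheres `isZero_singularHomology_unitSphere`
  + universal coefficients over the field `ℝ`, `isZero_singularCohomology_of_isZero_of_free`),
  hence `H²(Σ; ℝ) = 0` by homotopy invariance (`singularCohomology.isoOfHomotopyEquiv'`);
  `H²(ℝ⁴ ∖ 0; ℝ) = 0` likewise (`isIso_singularHomology_map_sphereToComplZero`); and the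
  Mayer–Vietoris extension across the acyclic overlap of the cover `Σ = (Σ ∖ p) ∪ (open cell)`
  (`singularCohomology.exists_map_subsetIncl_eq_of_isZero`, as in `FinitePunctureCohomology`)
  makes `H²(Σ; ℝ) → H²(Σ ∖ p; ℝ)` surjective, so `H²(Σ ∖ p; ℝ) = 0` (Hatcher 2002, §3.1, §3.3);
* de Rham's theorem for the open manifold `Σ ∖ p` (`deRhamComparisonIso`, `deRhamIsoLocal` of
  `DeRhamComparison`, Bredon 1993 Thm. V.9.5) turns this into the vanishing of `H²_dR(Σ ∖ p)`, and
  `mem_localExactForms_succ_iff` produces the smooth primitive.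

No named facts, no definitions.
-/

-- the registered namespace `Summit.SmoothPoincare4.SmoothPoincare4.…` repeats a component (P = Sub)
set_option linter.dupNamespace false

noncomputable section

open scoped Manifold ContDiff Topology
open Set CategoryTheory Limits
open Literature.Geometry.Kaehler Literature.Geometry.Symplectic Literature.Topology.FourManifolds
open Literature.AlgebraicTopology.SingularHomology Literature.Geometry.Manifold

namespace Summit.SmoothPoincare4.SmoothPoincare4.Cruxes.HyperbolicEnd.TaubesCirclePencil

/-! ### Singular cohomology: `H²(Σ ∖ p; ℝ) = 0` -/

/-- `H²(ℝ⁴ ∖ 0; ℝ) = 0` (`ℝ⁴ ∖ 0 ≃ S³`, homology of spheres, universal coefficients over a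
field). [cite: HatcherAT2002, Cor. 2.14 and Thm. 3.2] -/
theorem isZero_singularCohomology_two_complZero_real :
    IsZero (singularCohomology ℝ ℝ ↥(({0}ᶜ : Set (EuclideanSpace ℝ (Fin (3 + 1))))) 2) := by
  have hH : IsZero (singularHomology ℝ ℝ ↥(({0}ᶜ : Set (EuclideanSpace ℝ (Fin (3 + 1))))) 2) := by
    haveI := isIso_singularHomology_map_sphereToComplZero ℝ ℝ 3 2
    exact (isZero_singularHomology_unitSphere ℝ ℝ 3 2 (by norm_num) (by norm_num)).of_iso
      (asIso (singularHomology.map ℝ ℝ (sphereToComplZero 3) 2)).symm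
  exact isZero_singularCohomology_of_isZero_of_free (injective_kroneckerMap_of_free_holds ℝ _ 1)
    inferInstance hH

/-- `H²(S⁴; ℝ) = 0`. [cite: HatcherAT2002, Cor. 2.14 and Thm. 3.2] -/
theorem isZero_singularCohomology_two_sphere_four_real :
    IsZero (singularCohomology ℝ ℝ ↥(Metric.sphere (0 : EuclideanSpace ℝ (Fin (4 + 1))) 1) 2) :=
  isZero_singularCohomology_of_isZero_of_free (injective_kroneckerMap_of_free_holds ℝ _ 1)
    inferInstance (isZero_singularHomology_unitSphere ℝ ℝ 4 2 (by norm_num) (by norm_num))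

variable (S : HomotopySphere 4) (p : S.carrier)

/-- `H²(Σ; ℝ) = 0` for a homotopy `4`-sphere `Σ` (homotopy invariance).
[cite: HatcherAT2002, §3.1 p. 201] -/
theorem isZero_singularCohomology_two_homotopySphere :
    IsZero (singularCohomology ℝ ℝ S.carrier 2) := by
  obtain ⟨e⟩ := S.nonempty_homotopyEquiv
  exact (isZero_singularCohomology_two_sphere_four_real).of_iso
    (singularCohomology.isoOfHomotopyEquiv' ℝ ℝ e 2).symm

/-- `H²(Σ; ℝ) → H²(Σ ∖ p; ℝ)` is surjective (Mayer–Vietoris for `Σ = (Σ ∖ p) ∪ i(ℝ⁴)` with the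
acyclic overlap `i(ℝ⁴) ∖ p ≅ ℝ⁴ ∖ 0`; the real-coefficient twin of
`map_subsetIncl_compl_singleton_surjective`). [cite: HatcherAT2002, §3.1 pp. 203–204 and §3.3 p. 231] -/
theorem map_subsetIncl_compl_singleton_surjective_real :
    Function.Surjective (singularCohomology.map ℝ ℝ (subsetIncl ({p}ᶜ : Set S.carrier)) 2) := by
  obtain ⟨i, hi, rfl⟩ := Literature.AlgebraicTopology.Homotopy.exists_isOpenEmbedding_apply_zero_eq
    (E := EuclideanSpace ℝ (Fin (3 + 1))) p
  have hcover : ({i 0}ᶜ : Set S.carrier) ∪ range i = univ := by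
    refine eq_univ_of_forall fun x ↦ ?_
    by_cases hx : x = i 0
    · exact Or.inr ⟨0, hx.symm⟩
    · exact Or.inl hx
  have hZ : IsZero (singularCohomology ℝ ℝ (↥(({i 0}ᶜ : Set S.carrier) ∩ range i)) 2) :=
    isZero_singularCohomology_two_complZero_real.of_iso
      (singularCohomology.mapIso ℝ ℝ (complZeroHomeomorphInter hi.isEmbedding) 2)
  intro a
  obtain ⟨c, hc, -⟩ := singularCohomology.exists_map_subsetIncl_eq_of_isZero ℝ
    isOpen_compl_singleton hi.isOpen_range hcover hZ a
  exact ⟨c, hc⟩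

/-- **`H²(Σ ∖ p; ℝ) = 0`** for a homotopy `4`-sphere `Σ` and `p ∈ Σ`.
[cite: HatcherAT2002, §3.1 pp. 203–204 and §3.3 p. 231] -/
theorem isZero_singularCohomology_two_punctured :
    IsZero (singularCohomology ℝ ℝ ↥(punctured p) 2) := by
  have h : IsZero (singularCohomology ℝ ℝ ↥(({p}ᶜ : Set S.carrier)) 2) := by
    haveI : Subsingleton (singularCohomology ℝ ℝ S.carrier 2) :=
      ModuleCat.subsingleton_of_isZero (isZero_singularCohomology_two_homotopySphere S)
    haveI : Subsingleton (singularCohomology ℝ ℝ ↥(({p}ᶜ : Set S.carrier)) 2) :=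
      (map_subsetIncl_compl_singleton_surjective_real S p).subsingleton
    exact ModuleCat.isZero_iff_subsingleton.mpr inferInstance
  exact h

/-! ### De Rham: the primitive -/

/-- The punctured sphere is locally compact (an open subspace of a compact Hausdorff space).
[folklore] -/
theorem locallyCompactSpace_punctured : LocallyCompactSpace ↥(punctured p) :=
  (punctured p).isOpen.locallyCompactSpace

-- registered signature, verbatim on one line (gate matches name + header textually)
/-- **Closed `2`-forms on a punctured homotopy `4`-sphere are exact**: for every homotopy
`4`-sphere `Σ`, `p ∈ Σ` and every smooth closed `2`-form `sf` on `Σ ∖ p` there is a smooth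
`1`-form `λ` with `dλ = sf` — de Rham's theorem (`deRhamComparisonIso`, Bredon 1993 Thm. V.9.5)
and `H²(Σ ∖ p; ℝ) = 0` (`isZero_singularCohomology_two_punctured`).  The topological input of
`stub_noWitnessOffDefect`. [cite: Bredon1993, Thm. V.9.5] -/
theorem helper_exists_primitive_two_punctured : ∀ (S : HomotopySphere 4) (p : S.carrier) (sf : MForm (𝓡 4) ↥(punctured p) ℝ 2), IsSmoothForm sf → IsClosedForm sf → ∃ lam : MForm (𝓡 4) ↥(punctured p) ℝ 1, IsSmoothForm lam ∧ mextDeriv lam = sf := by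
  intro S p sf hs hc
  haveI := locallyCompactSpace_punctured S p
  -- the class of `sf` vanishes
  have h1 : IsZero ((localDeRhamComplex (𝓡 4) ℝ
      (isOpen_univ : IsOpen (univ : Set ↥(punctured p)))).homology 2) :=
    (isZero_singularCohomology_two_punctured S p).of_iso (deRhamComparisonIso (𝓡 4) ↥(punctured p) 2)
  have h2 : deRhamIsoLocal (𝓡 4) ↥(punctured p) ℝ 2 (deRhamCohomology.mk ⟨sf, hs, hc⟩) = 0 := by
    haveI : Subsingleton ((localDeRhamComplex (𝓡 4) ℝ
        (isOpen_univ : IsOpen (univ : Set ↥(punctured p)))).homology 2) :=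
      ModuleCat.subsingleton_of_isZero h1
    exact Subsingleton.elim _ _
  have h3 : deRhamCohomology.mk (I := 𝓡 4) (M := ↥(punctured p)) (F := ℝ) (k := 2) ⟨sf, hs, hc⟩ = 0 := by
    simpa using h2
  have h4 : sf ∈ exactSmoothForms (𝓡 4) ↥(punctured p) ℝ 2 := by
    have := (deRhamCohomology.mk_eq_mk_iff (I := 𝓡 4) (M := ↥(punctured p)) (F := ℝ) (k := 2)
      ⟨sf, hs, hc⟩ 0).1 (by simpa using h3)
    simpa using this
  -- an exact form on `univ` has a smooth primitive
  have h5 := mem_localExactForms_univ_of_mem_exactSmoothForms h4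
  obtain ⟨β, hβ⟩ := (mem_localExactForms_succ_iff isOpen_univ).1 h5
  refine ⟨β, fun x => β.2.1 x (mem_univ x), ?_⟩
  rw [← hβ, coe_localD, MForm.restr_univ]

end Summit.SmoothPoincare4.SmoothPoincare4.Cruxes.HyperbolicEnd.TaubesCirclePencil

end
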